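import Summits.Ventures.HSemireg.WedgeHankelRecurrenceGaussRecurrenceCoefficients

/-!
# Venture HSemireg — **CHRISTOFFEL'S THEOREM FOR ONE LINEAR FACTOR**: for a positive discrete measure `(ν, w)` with orthogonal polynomials `q_0, …, q_n` and kernel
# `K_n(x, c) = Σ_{k≤n} q_k(c) q_k(x) ∕ h_k`, the kernel polynomial is orthogonal to every `G` with `deg G < n` for the MODIFIED measure `(w − c)·ν` (reproducing property at `(X − c)G`); if
# `q_n(c) ≠ 0` it has exact degree `n` and leading coefficient `q_n(c) ∕ h_n`, so when `(w_l − c) ν_l > 0` the monic orthogonal polynomial of degree `n` for `(w − c)ν` is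
# `Q = (h_n ∕ q_n(c)) K_n(·, c)`, i.e. `(x − c) q_n(c) Q(x) = q_{n+1}(x) q_n(c) − q_n(x) q_{n+1}(c)` (Christoffel–Darboux)

HONEST FRAMING. Part of the Lean index of the computation cell `pub-hsemireg` (seat p10 gen 43, Sunday typer «UNIFORM-IN-n»).  Real polynomials and finite sums only; no variety, no cohomology
theory, no sheaf, no Ext group and no semiregularity map is constructed here; nothing here says that HC / HC_CM / HC_AV holds; no Literature fact (unproved `Prop`) is declared or used.  Custodian
versions as in `WedgeHankelSiegelIdeal` (1/3).
SOURCES (cited).  E. B. Christoffel, *Über die Gaußische Quadratur und eine Verallgemeinerung derselben*, J. reine angew. Math. 55 (1858) 61–82; G. Szegő, *Orthogonal Polynomials*, Thm 2.5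
(Christoffel's formula, the case of one linear factor `ρ(x) = x − c`) and Thm 3.1.4; T. S. Chihara, *An Introduction to Orthogonal Polynomials* (1978), Ch. I §7, Thm 7.1 (kernel polynomials are the
orthogonal polynomials of `(x − κ) dψ`); W. Gautschi, *Orthogonal Polynomials: Computation and Approximation* (2004), §2.4.2 (modification by a linear factor).
PROOF TYPED HERE.  `Σ_l ν_l (w_l − c) K_n(w_l, c) G(w_l) = Σ_l ν_l (K_n(·, c) · (X − c)G)(w_l) = ((X − c)G)(c) = 0` by N277 `kernel_reproducing` (`deg (X − c)G ≤ n`); the top coefficient of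
`K_n(·, c)` is `q_n(c) ∕ h_n` (Mathlib `finsetSum_coeff`); uniqueness by N290 `orthogonal_monic_unique` for the positive measure `((w − c)ν, w)`; the product form by N299 `christoffel_darboux_kernel`.
DEDUP DISCLOSURE (`rg -n 'christoffel_theorem|kernel_orthogonal_shifted|kernelPoly_natDegree' Summits Literature`, 2026-09-03): N268 (`GaussKernelNodes`) proves the INTERLACING of the zeros of the
kernel polynomial with the Gauss nodes via moments of `(V − c) dM`, without identifying the polynomial; the identification (Christoffel's theorem) is new.  The 5 names below: 0 hits tree-wide.

WHAT IS IN THE TREE.  N277 `kernel_reproducing`, `natDegree_reproducingKernel_le`; N273 `sum_mul_eval_sq_pos_of_natDegree_lt`; N279 `recurrence_monic_natDegree`; N290 `orthogonal_monic_unique`; N299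
`christoffel_darboux_kernel`; Mathlib `Polynomial.finsetSum_coeff`, `coeff_C_mul`, `natDegree_eq_of_le_of_coeff_ne_zero`, `Monic.def`.
THIS FILE (namespace `Summit.Ventures.HSemireg.Wedge.HankelOuter` continued; CHAINED on N303 (import), N277, N290, N299; 0 definitions — the kernel is the inline polynomial of N277):
* §1069 **`kernel_orthogonal_shifted`** (`Σ_l ν_l (w_l − c) · (K_n(·,c) G)(w_l) = 0` for `deg G < n`), `coeff_kernelPoly_top` (`[X^n] K_n(·, c) = q_n(c) ∕ h_n`), `natDegree_kernelPoly_eq` (`= n` when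
  `q_n(c) ≠ 0`), **`christoffel_theorem_linear`** (CHRISTOFFEL: the monic orthogonal polynomial of degree `n` for `((w − c)ν, w)` is `(h_n ∕ q_n(c)) K_n(·, c)`), **`christoffel_theorem_linear_eval`**
  (`(x − c) q_n(c) Q(x) = q_{n+1}(x) q_n(c) − q_n(x) q_{n+1}(c)` when the `q_k` obey a recurrence).
CAVEATS.  One linear factor only (Szegő's general `ρ` of degree `l` is a determinant of kernels — not typed); positivity of `(w − c)ν` is assumed (e.g. `c` below the support).  Nothing Ext-side.
New names only.
-/

open Module Polynomial
open scoped Matrix Polynomial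

namespace Summit.Ventures.HSemireg.Wedge.HankelOuter

/-! ## §1069. Christoffel's theorem for `(x − c) dν` -/

/-- **The kernel polynomial is orthogonal for the modified measure**: for `deg G < n ≤ m`, `Σ_l ν_l (w_l − c) · (K_n(·, c) · G)(w_l) = 0` (the reproducing property at `(X − c) G`, which vanishes at `c`).
[Chihara I Thm 7.1; Szegő Thm 2.5 (proof); this file, §1069] -/
theorem kernel_orthogonal_shifted {N m : ℕ} {ν w : Fin N → ℝ} {q : ℕ → ℝ[X]} (hmonic : ∀ k, k ≤ m → (q k).Monic) (hdeg : ∀ k, k ≤ m → (q k).natDegree = k)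
    (horth : ∀ k, k ≤ m → ∀ G : ℝ[X], G.natDegree < k → ∑ l, ν l * (q k * G).eval (w l) = 0) (hh : ∀ k, k ≤ m → ∑ l, ν l * ((q k).eval (w l)) ^ 2 ≠ 0)
    {n : ℕ} (hn : n ≤ m) (c : ℝ) {G : ℝ[X]} (hG : G.natDegree < n) :
    ∑ l, (ν l * (w l - c)) * ((∑ k ∈ Finset.range (n + 1), C ((q k).eval c / ∑ l, ν l * ((q k).eval (w l)) ^ 2) * q k) * G).eval (w l) = 0 := by
  have hP : ((Polynomial.X - C c) * G).natDegree ≤ n := by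
    refine (natDegree_mul_le).trans ?_
    rw [natDegree_X_sub_C]; omega
  have h := kernel_reproducing hmonic hdeg horth hh hn hP c
  rw [eval_mul, eval_sub, eval_X, eval_C, sub_self, zero_mul] at h
  rw [← h]
  refine Finset.sum_congr rfl fun l _ => ?_
  simp only [eval_mul, eval_sub, eval_X, eval_C]
  ring

/-- **`[X^n] K_n(·, c) = q_n(c) ∕ h_n`** (the lower terms have degree `< n`). [Szegő (3.1.9); this file, §1069] -/
theorem coeff_kernelPoly_top {N n : ℕ} (ν w : Fin N → ℝ) {q : ℕ → ℝ[X]} (hmonic : ∀ k, k ≤ n → (q k).Monic) (hdeg : ∀ k, k ≤ n → (q k).natDegree = k) (c : ℝ) :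
    (∑ k ∈ Finset.range (n + 1), C ((q k).eval c / ∑ l, ν l * ((q k).eval (w l)) ^ 2) * q k).coeff n = (q n).eval c / ∑ l, ν l * ((q n).eval (w l)) ^ 2 := by
  rw [finsetSum_coeff, Finset.sum_range_succ, Finset.sum_eq_zero fun k hk => ?_, zero_add, coeff_C_mul]
  · have h1 : (q n).coeff n = 1 := by have := (hmonic n le_rfl).coeff_natDegree; rwa [hdeg n le_rfl] at this
    rw [h1, mul_one]
  · have hk' : k < n := Finset.mem_range.1 hk
    rw [coeff_C_mul, coeff_eq_zero_of_natDegree_lt (by rw [hdeg k hk'.le]; exact hk'), mul_zero]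

/-- **`deg K_n(·, c) = n` when `q_n(c) ≠ 0`** (positive measure, `n < N`). [Szegő Thm 3.1.4; this file, §1069] -/
theorem natDegree_kernelPoly_eq {N n : ℕ} {ν w : Fin N → ℝ} (hν : ∀ l, 0 < ν l) (hw : Function.Injective w) (hnN : n < N) {q : ℕ → ℝ[X]}
    (hmonic : ∀ k, k ≤ n → (q k).Monic) (hdeg : ∀ k, k ≤ n → (q k).natDegree = k) {c : ℝ} (hc : (q n).eval c ≠ 0) :
    (∑ k ∈ Finset.range (n + 1), C ((q k).eval c / ∑ l, ν l * ((q k).eval (w l)) ^ 2) * q k).natDegree = n := by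
  have hh : 0 < ∑ l, ν l * ((q n).eval (w l)) ^ 2 := sum_mul_eval_sq_pos_of_natDegree_lt hν hw (hmonic n le_rfl).ne_zero (by rw [hdeg n le_rfl]; exact hnN)
  refine natDegree_eq_of_le_of_coeff_ne_zero (natDegree_reproducingKernel_le (ν := ν) (w := w) hdeg c) ?_
  rw [coeff_kernelPoly_top ν w hmonic hdeg c]
  exact div_ne_zero hc hh.ne'

/-- **CHRISTOFFEL'S THEOREM (one linear factor).**  Let `ν_l > 0` on `N` distinct nodes `w_l`, `n < N`, with orthogonal polynomials `q_0 = 1, …, q_n`; let `c` be real with `q_n(c) ≠ 0` and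
`(w_l − c) ν_l > 0` for all `l` (e.g. `c < min_l w_l`); and let `Q` be the monic polynomial of degree `n` orthogonal to all lower degrees for the measure `((w − c)ν, w)`.  Then
`Q = (h_n ∕ q_n(c)) · K_n(·, c)`, `K_n(·, c) = Σ_{k≤n} q_k(c) q_k ∕ h_k`. [Christoffel 1858; Szegő Thm 2.5; Chihara I Thm 7.1; Gautschi §2.4.2; this file, §1069] -/
theorem christoffel_theorem_linear {N n : ℕ} {ν w : Fin N → ℝ} (hν : ∀ l, 0 < ν l) (hw : Function.Injective w) (hnN : n < N) {q : ℕ → ℝ[X]}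
    (hmonic : ∀ k, k ≤ n → (q k).Monic) (hdeg : ∀ k, k ≤ n → (q k).natDegree = k)
    (horth : ∀ k, k ≤ n → ∀ G : ℝ[X], G.natDegree < k → ∑ l, ν l * (q k * G).eval (w l) = 0) {c : ℝ} (hc : (q n).eval c ≠ 0) (hpos : ∀ l, 0 < ν l * (w l - c))
    {Q : ℝ[X]} (hQm : Q.Monic) (hQd : Q.natDegree = n) (hQo : ∀ G : ℝ[X], G.natDegree < n → ∑ l, (ν l * (w l - c)) * (Q * G).eval (w l) = 0) :
    Q = C ((∑ l, ν l * ((q n).eval (w l)) ^ 2) / (q n).eval c) * ∑ k ∈ Finset.range (n + 1), C ((q k).eval c / ∑ l, ν l * ((q k).eval (w l)) ^ 2) * q k := by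
  set K : ℝ[X] := ∑ k ∈ Finset.range (n + 1), C ((q k).eval c / ∑ l, ν l * ((q k).eval (w l)) ^ 2) * q k with hK
  have hh : ∀ k, k ≤ n → ∑ l, ν l * ((q k).eval (w l)) ^ 2 ≠ 0 := fun k hk =>
    (sum_mul_eval_sq_pos_of_natDegree_lt hν hw (hmonic k hk).ne_zero (by rw [hdeg k hk]; omega)).ne'
  have hKd : K.natDegree = n := natDegree_kernelPoly_eq hν hw hnN hmonic hdeg hc
  have hKtop : K.coeff n = (q n).eval c / ∑ l, ν l * ((q n).eval (w l)) ^ 2 := coeff_kernelPoly_top ν w hmonic hdeg c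
  have hsc : (∑ l, ν l * ((q n).eval (w l)) ^ 2) / (q n).eval c ≠ 0 := div_ne_zero (hh n le_rfl) hc
  -- the rescaled kernel is monic of degree `n` and orthogonal for the modified measure
  have hPd : (C ((∑ l, ν l * ((q n).eval (w l)) ^ 2) / (q n).eval c) * K).natDegree = n := by rw [natDegree_C_mul hsc, hKd]
  have hPm : (C ((∑ l, ν l * ((q n).eval (w l)) ^ 2) / (q n).eval c) * K).Monic := by
    rw [Monic.def, leadingCoeff, hPd, coeff_C_mul, hKtop, div_mul_div_comm, mul_comm, div_self (mul_ne_zero hc (hh n le_rfl))]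
  have hPo : ∀ G : ℝ[X], G.natDegree < n → ∑ l, (ν l * (w l - c)) * ((C ((∑ l, ν l * ((q n).eval (w l)) ^ 2) / (q n).eval c) * K) * G).eval (w l) = 0 := fun G hG => by
    have h := kernel_orthogonal_shifted hmonic hdeg horth hh le_rfl c hG
    have hl : ∀ l, (ν l * (w l - c)) * ((C ((∑ l, ν l * ((q n).eval (w l)) ^ 2) / (q n).eval c) * K) * G).eval (w l) =
        ((∑ l, ν l * ((q n).eval (w l)) ^ 2) / (q n).eval c) * ((ν l * (w l - c)) * (K * G).eval (w l)) := fun l => by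
      simp only [eval_mul, eval_C]; ring
    rw [Finset.sum_congr rfl fun l _ => hl l, ← Finset.mul_sum, h, mul_zero]
  exact orthogonal_monic_unique hpos hw hnN.le hQm hQd hPm hPd hQo hPo

/-- **Christoffel's theorem in product form**: with the recurrence `(a, b, q)` extending the orthogonal system up to degree `n + 1`, the monic orthogonal polynomial `Q` of degree `n` for
`((w − c)ν, w)` satisfies `(x − c) · q_n(c) · Q(x) = q_{n+1}(x) q_n(c) − q_n(x) q_{n+1}(c)` for every real `x`. [Szegő Thm 2.5 (`l = 1`); Chihara I (7.3); this file, §1069] -/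
theorem christoffel_theorem_linear_eval {N n : ℕ} {ν w : Fin N → ℝ} (hν : ∀ l, 0 < ν l) (hw : Function.Injective w) (hnN : n + 1 < N) {q : ℕ → ℝ[X]} {a b : ℕ → ℝ}
    (hq0 : q 0 = 1) (hq1 : q 1 = Polynomial.X - C (a 0)) (hrec : ∀ n, q (n + 2) = (Polynomial.X - C (a (n + 1))) * q (n + 1) - C (b (n + 1)) * q n)
    (horth : ∀ k, k ≤ n + 1 → ∀ G : ℝ[X], G.natDegree < k → ∑ l, ν l * (q k * G).eval (w l) = 0) {c : ℝ} (hc : (q n).eval c ≠ 0) (hpos : ∀ l, 0 < ν l * (w l - c))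
    {Q : ℝ[X]} (hQm : Q.Monic) (hQd : Q.natDegree = n) (hQo : ∀ G : ℝ[X], G.natDegree < n → ∑ l, (ν l * (w l - c)) * (Q * G).eval (w l) = 0) (x : ℝ) :
    (x - c) * (q n).eval c * Q.eval x = (q (n + 1)).eval x * (q n).eval c - (q n).eval x * (q (n + 1)).eval c := by
  have hmd := recurrence_monic_natDegree hq0 hq1 hrec
  have hQ := christoffel_theorem_linear hν hw (by omega) (fun k _ => (hmd k).1) (fun k _ => (hmd k).2) (fun k hk => horth k (by omega)) hc hpos hQm hQd hQo
  have hcd := christoffel_darboux_kernel hν hw hnN hq0 hq1 hrec horth (m := n + 1) le_rfl x c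
  rw [hQ, eval_mul, eval_C, eval_finsetSum]
  rw [← hcd]
  have hterms : ∑ k ∈ Finset.range (n + 1), (C ((q k).eval c / ∑ l, ν l * ((q k).eval (w l)) ^ 2) * q k).eval x =
      ∑ k ∈ Finset.range (n + 1), (q k).eval x * (q k).eval c / ∑ l, ν l * ((q k).eval (w l)) ^ 2 :=
    Finset.sum_congr rfl fun k _ => by rw [eval_mul, eval_C]; ring
  rw [hterms]
  field_simp

end Summit.Ventures.HSemireg.Wedge.HankelOuter
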